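import Mathlib
import Literature.Analysis.FluidPDE.VectorCalculus
import Summits.NavierStokesRegularity.NavierStokesRegularity.Theorems.FilamentSkeletonRssClause13RAdjointEnergy
import Summits.NavierStokesRegularity.NavierStokesRegularity.Theorems.FilamentSkeletonRssClause13REdgeClamping

/-!
# Clause 13-R, repaired item (c′) at MODEL level: the SOURCED adjoint equation produces an annihilating EDGE MEASURE
# (crux `Clause13RNearStraightL`, stmt-NavierStokesRegularity-23612; line `rate_bordered_split`, STUB R `stub_rateRow13RFlat`)

Route `FilamentSkeletonRss`, Variant A1R.  Model of census item (c) (`…Clause13RAdjointStraightModelWeights`): forward model operator on the ball `S = [a,b]`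
  `(LY)(σ) = cst • (m σ • (d × Y σ) − ∫_{τ∈S} k(τ−σ) • (d × Y τ) dτ) + ½ Y σ − α e × Y σ − w σ • Y′ σ`
(transpose of the adjoint weights: `⟪φ, d × Y⟫ = ⟪φ × d, Y⟫`, `⟪φ, e × Y⟫ = −⟪e × φ, Y⟫`, `∫⟪φ, −wY′⟫ = ∫⟪(wφ)′, Y⟫` on clamped `Y`).  By
`…Clause13RAdjointEnergy.model_adjoint_no_regular_annihilator` NO `C¹` weight annihilates `L` on the clamped class; THIS FILE proves the positive half of the
repaired item (c′) of the memo STRUCTURE-23612-edge-measures-leafhand16-g0.md: if `φ ∈ C¹` solves the adjoint equation SOURCED BY THE EDGE KERNELS,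
  `cst • (m σ • (φ σ × d) − ∫_{τ∈S} k(τ−σ) • (φ τ × d) dτ) + ½ φ σ + α e × φ σ + w′ σ φ σ + w σ φ′ σ = cst • (k(σ−b) • (e₊ × d) + k(σ−a) • (e₋ × d))`   (σ ∈ S),
then the EDGE MEASURE `μ = e₊ δ_b + e₋ δ_a + φ dσ` annihilates `LY` for every `C²` field `Y` vanishing off `S`:
  `∫_a^b ⟪φ, LY⟫ + ⟪e₊, (LY)(b)⟫ + ⟪e₋, (LY)(a)⟫ = 0`     (`edgeMeasure_annihilates`).
Ingredients: the test field is clamped at `a, b` (`…Clause13REdgeClamping.clamped_of_eqOn_open`), so `(LY)(b) = −cst ∫_S k(τ−b) • (d × Y τ) dτ` is the pure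
nonlocal leak (`model_forward_at_clamped`); Fubini for the nonlocal pairing with the EVEN kernel (`setIntegral_inner_nonlocal_swap`); integration by parts of the
transport term without boundary terms (`integral_transport_pairing`).  This is exactly the annihilation clause of the landed interface
`…Clause13REdgeMeasureCertificate.rateRow13RFlat_of_edgeMeasureCertificate` in the model (two atoms, at the exit stations).  [folklore]
Hand `leafhand-ns-filamentskeletonrs-16-g0` (LAND-ONLY); `--supports stmt-NavierStokesRegularity-23612` helper, def-free.  HONEST FRAMING: duality bookkeeping for the
MODEL of a HYPOTHETICAL filament skeleton on the NEGATIVE side of a MODEL blow-up route; no `φ` is constructed, STUB R is NOT proved, nothing here bears on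
Navier–Stokes regularity or blow-up.
-/

noncomputable section

open MeasureTheory Filter Topology Set intervalIntegral
open scoped RealInnerProductSpace InnerProductSpace
open Literature.Analysis.FluidPDE
open Summit.NavierStokesRegularity.NavierStokesRegularity.Theorems.Clause13RAdjointEnergy (inner_cross_left_swap)
open Summit.NavierStokesRegularity.NavierStokesRegularity.Theorems.Clause13REdgeClamping (clamped_of_eqOn_open)

namespace Summit.NavierStokesRegularity.NavierStokesRegularity.Theorems.Clause13REdgeMeasureModel
set_option linter.dupNamespace false

/-! ## §1 Pointwise transpose (the rotation transpose `⟪φ, e × y⟫ = −⟪e × φ, y⟫` is the landed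
`Clause13RClosedFormAdjoint.inner_cross_single_neg`, re-derived inline in §6 to keep this file's imports minimal) -/

/-- `⟪φ, d × y⟫ = ⟪φ × d, y⟫` (scalar triple product). [folklore] -/
theorem inner_cross_transpose (φ d y : EuclideanSpace ℝ (Fin 3)) : ⟪φ, cross d y⟫ = ⟪cross φ d, y⟫ := by
  simp only [cross, cross_apply, PiLp.inner_apply, RCLike.inner_apply, conj_trivial, Fin.sum_univ_three,
    Matrix.cons_val_zero, Matrix.cons_val_one, Matrix.cons_val_two, Matrix.head_cons, Matrix.tail_cons]
  ring

/-! ## §2 A `C²` field vanishing off `[a,b]` is clamped at `a` and `b` -/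

/-- If `Y ∈ C²` vanishes off `[a,b]` (`a < b`) then `Y a = 0`, `Y′ a = 0`, `Y b = 0`, `Y′ b = 0`. [folklore] -/
theorem clamped_endpoints {F : Type*} [NormedAddCommGroup F] [NormedSpace ℝ F] {Y : ℝ → F} (hY : ContDiff ℝ 2 Y) {a b : ℝ}
    (hoff : ∀ τ, τ ∉ Icc a b → Y τ = 0) : Y a = 0 ∧ deriv Y a = 0 ∧ Y b = 0 ∧ deriv Y b = 0 := by
  have hU : IsOpen (Icc a b)ᶜ := isClosed_Icc.isOpen_compl
  have hz : ∀ x ∈ (Icc a b)ᶜ, Y x = 0 := fun x hx => hoff x hx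
  have ha : a ∈ closure (Icc a b)ᶜ := by
    rw [Metric.mem_closure_iff]
    intro ε hε
    refine ⟨a - ε / 2, ?_, ?_⟩
    · simp only [mem_compl_iff, mem_Icc, not_and, not_le]; intro h; linarith
    · rw [Real.dist_eq, abs_of_nonneg (by linarith)]; linarith
  have hb : b ∈ closure (Icc a b)ᶜ := by
    rw [Metric.mem_closure_iff]
    intro ε hε
    refine ⟨b + ε / 2, ?_, ?_⟩
    · simp only [mem_compl_iff, mem_Icc, not_and, not_le]; intro _; linarith
    · rw [Real.dist_eq, abs_of_nonpos (by linarith)]; linarith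
  have hA := clamped_of_eqOn_open hY hU hz ha
  have hB := clamped_of_eqOn_open hY hU hz hb
  exact ⟨hA.1, hA.2.1, hB.1, hB.2.1⟩

/-! ## §3 The forward model operator at a clamped station is the pure nonlocal leak -/

/-- At a station where `Y σ = 0` and `Y′ σ = 0` the forward model operator reduces to `−cst • ∫_S k(τ−σ) • (d × Y τ) dτ`. [folklore] -/
theorem model_forward_at_clamped {a b cst α : ℝ} {k m w : ℝ → ℝ} {Y Y' : ℝ → EuclideanSpace ℝ (Fin 3)} {d e : EuclideanSpace ℝ (Fin 3)} {σ : ℝ}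
    (hY0 : Y σ = 0) (hY1 : Y' σ = 0) :
    cst • (m σ • cross d (Y σ) - ∫ τ in Icc a b, k (τ - σ) • cross d (Y τ)) + (1 / 2 : ℝ) • Y σ - α • cross e (Y σ) - w σ • Y' σ
      = -(cst • ∫ τ in Icc a b, k (τ - σ) • cross d (Y τ)) := by
  have hc0 : ∀ x : EuclideanSpace ℝ (Fin 3), cross x 0 = 0 := fun x => by rw [← crossCLM_apply, map_zero]
  rw [hY0, hY1, hc0, hc0, smul_zero, smul_zero, smul_zero, smul_zero, zero_sub, smul_neg, add_zero, sub_zero, sub_zero]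

/-! ## §4 The nonlocal pairing: Fubini with an even kernel -/

/-- **Nonlocal transposition.**  For continuous `k` (even), `φ`, `Y` on `[a,b]`:
`∫_{σ∈S} ⟪φ σ, ∫_{τ∈S} k(τ−σ) • (d × Y τ) dτ⟫ dσ = ∫_{τ∈S} ⟪∫_{σ∈S} k(σ−τ) • (φ σ × d) dσ, Y τ⟫ dτ`. [folklore] -/
theorem setIntegral_inner_nonlocal_swap {a b : ℝ} {k : ℝ → ℝ} (hk : Continuous k) (hkev : ∀ s, k (-s) = k s)
    {φ Y : ℝ → EuclideanSpace ℝ (Fin 3)} (hφ : Continuous φ) (hY : Continuous Y) (d : EuclideanSpace ℝ (Fin 3)) :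
    ∫ σ in Icc a b, ⟪φ σ, ∫ τ in Icc a b, k (τ - σ) • cross d (Y τ)⟫
      = ∫ τ in Icc a b, ⟪∫ σ in Icc a b, k (σ - τ) • cross (φ σ) d, Y τ⟫ := by
  set F : ℝ → ℝ → ℝ := fun σ τ => k (τ - σ) * ⟪cross (φ σ) d, Y τ⟫ with hF
  have hcrossφ : Continuous fun σ => cross (φ σ) d := by
    have : Continuous fun σ => crossCLM (φ σ) d := (crossCLM.continuous₂).comp₂ hφ continuous_const
    simpa only [crossCLM_apply] using this
  have hcrossY : Continuous fun τ => cross d (Y τ) := by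
    have : Continuous fun τ => crossCLM d (Y τ) := (crossCLM.continuous₂).comp₂ continuous_const hY
    simpa only [crossCLM_apply] using this
  have hFc : Continuous (Function.uncurry F) := by
    have h1 : Continuous fun p : ℝ × ℝ => k (p.2 - p.1) := hk.comp (continuous_snd.sub continuous_fst)
    have h2 : Continuous fun p : ℝ × ℝ => ⟪cross (φ p.1) d, Y p.2⟫ :=
      (hcrossφ.comp continuous_fst).inner (hY.comp continuous_snd)
    exact h1.mul h2
  -- left side as a double integral of `F`
  have hL : ∀ σ, ⟪φ σ, ∫ τ in Icc a b, k (τ - σ) • cross d (Y τ)⟫ = ∫ τ in Icc a b, F σ τ := by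
    intro σ
    have hint : IntegrableOn (fun τ => k (τ - σ) • cross d (Y τ)) (Icc a b) :=
      ((hk.comp (continuous_id.sub continuous_const)).smul hcrossY).continuousOn.integrableOn_compact isCompact_Icc
    rw [← integral_inner hint (φ σ)]
    refine integral_congr_ae (Eventually.of_forall fun τ => ?_)
    simp only [hF, inner_smul_right, inner_cross_transpose]
  -- right side as a double integral of `F` (swapped)
  have hR : ∀ τ, ⟪∫ σ in Icc a b, k (σ - τ) • cross (φ σ) d, Y τ⟫ = ∫ σ in Icc a b, F σ τ := by
    intro τ
    have hint : IntegrableOn (fun σ => k (σ - τ) • cross (φ σ) d) (Icc a b) :=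
      ((hk.comp (continuous_id.sub continuous_const)).smul hcrossφ).continuousOn.integrableOn_compact isCompact_Icc
    rw [real_inner_comm, ← integral_inner hint (Y τ)]
    refine integral_congr_ae (Eventually.of_forall fun σ => ?_)
    have hkk : k (σ - τ) = k (τ - σ) := by rw [← hkev (τ - σ), neg_sub]
    simp only [hF, inner_smul_right, real_inner_comm (Y τ), hkk]
  simp_rw [hL, hR]
  have hprod : Integrable (Function.uncurry F) ((volume.restrict (Icc a b)).prod (volume.restrict (Icc a b))) := by
    rw [Measure.prod_restrict]
    exact hFc.continuousOn.integrableOn_compact (isCompact_Icc.prod isCompact_Icc)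
  exact integral_integral_swap hprod

/-! ## §5 The transport pairing: integration by parts without boundary terms -/

/-- **Transport by parts on a clamped field**: if `Y a = Y b = 0` then `∫_a^b ⟪φ, −w•Y′⟫ = ∫_a^b ⟪w′•φ + w•φ′, Y⟫`. [folklore] -/
theorem integral_transport_pairing {a b : ℝ} {w w' : ℝ → ℝ} {φ φ' Y Y' : ℝ → EuclideanSpace ℝ (Fin 3)}
    (hw : ∀ σ, HasDerivAt w (w' σ) σ) (hφ : ∀ σ, HasDerivAt φ (φ' σ) σ) (hYd : ∀ σ, HasDerivAt Y (Y' σ) σ)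
    (hw'c : Continuous w') (hφ'c : Continuous φ') (hY'c : Continuous Y') (hYa : Y a = 0) (hYb : Y b = 0) :
    ∫ σ in a..b, ⟪φ σ, -(w σ • Y' σ)⟫ = ∫ σ in a..b, ⟪w' σ • φ σ + w σ • φ' σ, Y σ⟫ := by
  have hwc : Continuous w := continuous_iff_continuousAt.2 fun σ => (hw σ).continuousAt
  have hφc : Continuous φ := continuous_iff_continuousAt.2 fun σ => (hφ σ).continuousAt
  have hYc : Continuous Y := continuous_iff_continuousAt.2 fun σ => (hYd σ).continuousAt
  -- derivative of `σ ↦ w σ * ⟪φ σ, Y σ⟫`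
  have hderiv : ∀ σ ∈ uIcc a b, HasDerivAt (fun σ => w σ * ⟪φ σ, Y σ⟫)
      (w' σ * ⟪φ σ, Y σ⟫ + w σ * (⟪φ σ, Y' σ⟫ + ⟪φ' σ, Y σ⟫)) σ := by
    intro σ _
    have hi : HasDerivAt (fun σ => ⟪φ σ, Y σ⟫) (⟪φ σ, Y' σ⟫ + ⟪φ' σ, Y σ⟫) σ := (hφ σ).inner ℝ (hYd σ)
    exact (hw σ).mul hi
  have hint : IntervalIntegrable (fun σ => w' σ * ⟪φ σ, Y σ⟫ + w σ * (⟪φ σ, Y' σ⟫ + ⟪φ' σ, Y σ⟫)) volume a b :=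
    ((hw'c.mul (hφc.inner hYc)).add (hwc.mul ((hφc.inner hY'c).add (hφ'c.inner hYc)))).intervalIntegrable _ _
  have hFTC := integral_eq_sub_of_hasDerivAt hderiv hint
  rw [hYa, hYb, inner_zero_right, inner_zero_right, mul_zero, mul_zero, sub_zero] at hFTC
  -- rearrange
  have h1 : ∫ σ in a..b, ⟪φ σ, -(w σ • Y' σ)⟫ = ∫ σ in a..b, -(w σ * ⟪φ σ, Y' σ⟫) := by
    refine intervalIntegral.integral_congr fun σ _ => ?_
    simp only [inner_neg_right, inner_smul_right]
  have h2 : ∫ σ in a..b, ⟪w' σ • φ σ + w σ • φ' σ, Y σ⟫ = ∫ σ in a..b, (w' σ * ⟪φ σ, Y σ⟫ + w σ * ⟪φ' σ, Y σ⟫) := by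
    refine intervalIntegral.integral_congr fun σ _ => ?_
    simp only [inner_add_left, inner_smul_left, conj_trivial]
  rw [h1, h2]
  have hi1 : IntervalIntegrable (fun σ => -(w σ * ⟪φ σ, Y' σ⟫)) volume a b :=
    (hwc.mul (hφc.inner hY'c)).neg.intervalIntegrable _ _
  have hi2 : IntervalIntegrable (fun σ => w' σ * ⟪φ σ, Y σ⟫ + w σ * ⟪φ' σ, Y σ⟫) volume a b :=
    ((hw'c.mul (hφc.inner hYc)).add (hwc.mul (hφ'c.inner hYc))).intervalIntegrable _ _
  have hsum : (∫ σ in a..b, (w' σ * ⟪φ σ, Y σ⟫ + w σ * ⟪φ' σ, Y σ⟫)) - ∫ σ in a..b, -(w σ * ⟪φ σ, Y' σ⟫) = 0 := by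
    rw [← intervalIntegral.integral_sub hi2 hi1, ← hFTC]
    refine intervalIntegral.integral_congr fun σ _ => ?_
    ring
  linarith

/-! ## §6 The sourced adjoint equation produces an annihilating edge measure -/

/-- **EDGE MEASURE ANNIHILATION (model, repaired item (c′)).**  Let `a < b`, `k` continuous and even, `m, w ∈ C¹`-data continuous, and let `φ ∈ C¹` solve on
`S = [a,b]` the adjoint equation sourced by the edge kernels with atoms `e₊` (at `b`) and `e₋` (at `a`).  Then for every `C²` field `Y` vanishing off `S` the
edge measure `e₊δ_b + e₋δ_a + φ dσ` annihilates the forward model operator: `∫_a^b ⟪φ, LY⟫ + ⟪e₊, (LY)(b)⟫ + ⟪e₋, (LY)(a)⟫ = 0`. [folklore] -/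
theorem edgeMeasure_annihilates {a b cst α : ℝ} (hab : a < b) {k m w w' : ℝ → ℝ} {φ φ' : ℝ → EuclideanSpace ℝ (Fin 3)}
    {d e ep em : EuclideanSpace ℝ (Fin 3)}
    (hk : Continuous k) (hkev : ∀ s, k (-s) = k s) (hm : Continuous m)
    (hw : ∀ σ, HasDerivAt w (w' σ) σ) (hφ : ∀ σ, HasDerivAt φ (φ' σ) σ) (hw'c : Continuous w') (hφ'c : Continuous φ')
    (hsol : ∀ σ ∈ Icc a b,
      cst • (m σ • cross (φ σ) d - ∫ τ in Icc a b, k (τ - σ) • cross (φ τ) d)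
        + (1 / 2 : ℝ) • φ σ + α • cross e (φ σ) + w' σ • φ σ + w σ • φ' σ
        = cst • (k (σ - b) • cross ep d + k (σ - a) • cross em d))
    {Y : ℝ → EuclideanSpace ℝ (Fin 3)} (hY : ContDiff ℝ 2 Y) (hoff : ∀ τ, τ ∉ Icc a b → Y τ = 0) :
    (∫ σ in a..b, ⟪φ σ, cst • (m σ • cross d (Y σ) - ∫ τ in Icc a b, k (τ - σ) • cross d (Y τ))
        + (1 / 2 : ℝ) • Y σ - α • cross e (Y σ) - w σ • deriv Y σ⟫)
      + ⟪ep, cst • (m b • cross d (Y b) - ∫ τ in Icc a b, k (τ - b) • cross d (Y τ))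
        + (1 / 2 : ℝ) • Y b - α • cross e (Y b) - w b • deriv Y b⟫
      + ⟪em, cst • (m a • cross d (Y a) - ∫ τ in Icc a b, k (τ - a) • cross d (Y τ))
        + (1 / 2 : ℝ) • Y a - α • cross e (Y a) - w a • deriv Y a⟫ = 0 := by
  have hwc : Continuous w := continuous_iff_continuousAt.2 fun σ => (hw σ).continuousAt
  have hφc : Continuous φ := continuous_iff_continuousAt.2 fun σ => (hφ σ).continuousAt
  have hYc : Continuous Y := hY.continuous
  have hY'c : Continuous (deriv Y) := hY.continuous_deriv (by norm_num)
  have hYd : ∀ σ, HasDerivAt Y (deriv Y σ) σ := fun σ => (hY.differentiable (by norm_num) σ).hasDerivAt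
  obtain ⟨hYa, hY'a, hYb, hY'b⟩ := clamped_endpoints hY hoff
  have hrot : ∀ x y : EuclideanSpace ℝ (Fin 3), ⟪x, cross e y⟫ = -⟪cross e x, y⟫ := fun x y => by
    simp only [cross, cross_apply, PiLp.inner_apply, RCLike.inner_apply, conj_trivial, Fin.sum_univ_three,
      Matrix.cons_val_zero, Matrix.cons_val_one, Matrix.cons_val_two, Matrix.head_cons, Matrix.tail_cons]
    ring
  -- atoms = pure leaks
  rw [model_forward_at_clamped (Y' := deriv Y) hYb hY'b, model_forward_at_clamped (Y' := deriv Y) hYa hY'a]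
  -- continuity of the building blocks
  have hcrossY : Continuous fun τ => cross d (Y τ) := by
    have : Continuous fun τ => crossCLM d (Y τ) := (crossCLM.continuous₂).comp₂ continuous_const hYc
    simpa only [crossCLM_apply] using this
  have hcrossφ : Continuous fun σ => cross (φ σ) d := by
    have : Continuous fun σ => crossCLM (φ σ) d := (crossCLM.continuous₂).comp₂ hφc continuous_const
    simpa only [crossCLM_apply] using this
  have hcrosseY : Continuous fun τ => cross e (Y τ) := by
    have : Continuous fun τ => crossCLM e (Y τ) := (crossCLM.continuous₂).comp₂ continuous_const hYc
    simpa only [crossCLM_apply] using this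
  have hc1 : Continuous fun σ => cst • (m σ • cross (φ σ) d) + (1 / 2 : ℝ) • φ σ + α • cross e (φ σ) := by
    have hce : Continuous fun σ => cross e (φ σ) := by
      have : Continuous fun σ => crossCLM e (φ σ) := (crossCLM.continuous₂).comp₂ continuous_const hφc
      simpa only [crossCLM_apply] using this
    have h1 : Continuous fun σ => cst • (m σ • cross (φ σ) d) := (hm.smul hcrossφ).const_smul cst
    have h2 : Continuous fun σ => (1 / 2 : ℝ) • φ σ := hφc.const_smul (1 / 2 : ℝ)
    have h3 : Continuous fun σ => α • cross e (φ σ) := hce.const_smul α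
    exact (h1.add h2).add h3
  have hNY : Continuous fun σ => ∫ τ in Icc a b, k (τ - σ) • cross d (Y τ) := by
    have hj : Continuous (Function.uncurry fun σ τ => k (τ - σ) • cross d (Y τ)) :=
      (hk.comp (continuous_snd.sub continuous_fst)).smul (hcrossY.comp continuous_snd)
    exact continuous_parametric_integral_of_continuous hj isCompact_Icc
  have hNφ : Continuous fun τ => ∫ σ in Icc a b, k (σ - τ) • cross (φ σ) d := by
    have hj : Continuous (Function.uncurry fun τ σ => k (σ - τ) • cross (φ σ) d) :=
      (hk.comp (continuous_snd.sub continuous_fst)).smul (hcrossφ.comp continuous_snd)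
    exact continuous_parametric_integral_of_continuous hj isCompact_Icc
  -- Step 1: split the interval integral into local algebraic part, nonlocal part and transport part
  have hsplit : ∀ σ, ⟪φ σ, cst • (m σ • cross d (Y σ) - ∫ τ in Icc a b, k (τ - σ) • cross d (Y τ))
        + (1 / 2 : ℝ) • Y σ - α • cross e (Y σ) - w σ • deriv Y σ⟫
      = ⟪cst • (m σ • cross (φ σ) d) + (1 / 2 : ℝ) • φ σ + α • cross e (φ σ), Y σ⟫
        - cst * ⟪φ σ, ∫ τ in Icc a b, k (τ - σ) • cross d (Y τ)⟫ + ⟪φ σ, -(w σ • deriv Y σ)⟫ := by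
    intro σ
    simp only [inner_add_right, inner_sub_right, inner_smul_right, inner_add_left, inner_smul_left, conj_trivial, inner_neg_right,
      inner_cross_transpose (φ σ) d (Y σ), hrot (φ σ) (Y σ)]
    ring
  have hI : ∫ σ in a..b, ⟪φ σ, cst • (m σ • cross d (Y σ) - ∫ τ in Icc a b, k (τ - σ) • cross d (Y τ))
        + (1 / 2 : ℝ) • Y σ - α • cross e (Y σ) - w σ • deriv Y σ⟫
      = (∫ σ in a..b, ⟪cst • (m σ • cross (φ σ) d) + (1 / 2 : ℝ) • φ σ + α • cross e (φ σ), Y σ⟫)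
        - cst * (∫ σ in a..b, ⟪φ σ, ∫ τ in Icc a b, k (τ - σ) • cross d (Y τ)⟫)
        + ∫ σ in a..b, ⟪φ σ, -(w σ • deriv Y σ)⟫ := by
    have hi1 : IntervalIntegrable (fun σ => ⟪cst • (m σ • cross (φ σ) d) + (1 / 2 : ℝ) • φ σ + α • cross e (φ σ), Y σ⟫) volume a b :=
      (hc1.inner hYc).intervalIntegrable _ _
    have hi2 : IntervalIntegrable (fun σ => cst * ⟪φ σ, ∫ τ in Icc a b, k (τ - σ) • cross d (Y τ)⟫) volume a b :=
      (continuous_const.mul (hφc.inner hNY)).intervalIntegrable _ _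
    have hi3 : IntervalIntegrable (fun σ => ⟪φ σ, -(w σ • deriv Y σ)⟫) volume a b :=
      (hφc.inner (hwc.smul hY'c).neg).intervalIntegrable _ _
    rw [intervalIntegral.integral_congr (fun σ _ => hsplit σ), intervalIntegral.integral_add (hi1.sub hi2) hi3,
      intervalIntegral.integral_sub hi1 hi2, intervalIntegral.integral_const_mul]
  -- Step 2: nonlocal part by Fubini, transport part by parts
  have hN : ∫ σ in a..b, ⟪φ σ, ∫ τ in Icc a b, k (τ - σ) • cross d (Y τ)⟫
      = ∫ τ in a..b, ⟪∫ σ in Icc a b, k (σ - τ) • cross (φ σ) d, Y τ⟫ := by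
    rw [integral_of_le hab.le, integral_of_le hab.le, ← integral_Icc_eq_integral_Ioc, ← integral_Icc_eq_integral_Ioc]
    exact setIntegral_inner_nonlocal_swap hk hkev hφc hYc d
  have hT := integral_transport_pairing hw hφ hYd hw'c hφ'c hY'c hYa hYb
  rw [hI, hN, hT]
  -- Step 3: the atoms as integrals against `Y`
  have hatom : ∀ (x : ℝ) (ee : EuclideanSpace ℝ (Fin 3)),
      ⟪ee, -(cst • ∫ τ in Icc a b, k (τ - x) • cross d (Y τ))⟫ = -(cst * ∫ τ in a..b, ⟪k (τ - x) • cross ee d, Y τ⟫) := by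
    intro x ee
    have hint : IntegrableOn (fun τ => k (τ - x) • cross d (Y τ)) (Icc a b) :=
      ((hk.comp (continuous_id.sub continuous_const)).smul hcrossY).continuousOn.integrableOn_compact isCompact_Icc
    rw [inner_neg_right, inner_smul_right, ← integral_inner hint ee, integral_of_le hab.le, ← integral_Icc_eq_integral_Ioc]
    congr 2
    refine integral_congr_ae (Eventually.of_forall fun τ => ?_)
    simp only [inner_smul_right, inner_smul_left, conj_trivial, inner_cross_transpose]
  rw [hatom b ep, hatom a em]
  -- Step 4: everything is `∫ ⟪G τ, Y τ⟫` with `G = 0` by the sourced equation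
  have hi1 : IntervalIntegrable (fun σ => ⟪cst • (m σ • cross (φ σ) d) + (1 / 2 : ℝ) • φ σ + α • cross e (φ σ), Y σ⟫) volume a b :=
    (hc1.inner hYc).intervalIntegrable _ _
  have hi2 : IntervalIntegrable (fun τ => ⟪∫ σ in Icc a b, k (σ - τ) • cross (φ σ) d, Y τ⟫) volume a b :=
    (hNφ.inner hYc).intervalIntegrable _ _
  have hi3 : IntervalIntegrable (fun σ => ⟪w' σ • φ σ + w σ • φ' σ, Y σ⟫) volume a b :=
    (((hw'c.smul hφc).add (hwc.smul hφ'c)).inner hYc).intervalIntegrable _ _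
  have hi4 : ∀ (x : ℝ) (ee : EuclideanSpace ℝ (Fin 3)), IntervalIntegrable (fun τ => ⟪k (τ - x) • cross ee d, Y τ⟫) volume a b :=
    fun x ee => (((hk.comp (continuous_id.sub continuous_const)).smul continuous_const).inner hYc).intervalIntegrable _ _
  have hG : ∀ τ ∈ Icc a b, ⟪cst • (m τ • cross (φ τ) d) + (1 / 2 : ℝ) • φ τ + α • cross e (φ τ), Y τ⟫
      - cst * ⟪∫ σ in Icc a b, k (σ - τ) • cross (φ σ) d, Y τ⟫ + ⟪w' τ • φ τ + w τ • φ' τ, Y τ⟫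
      - cst * ⟪k (τ - b) • cross ep d, Y τ⟫ - cst * ⟪k (τ - a) • cross em d, Y τ⟫ = 0 := by
    intro τ hτ
    have h := hsol τ hτ
    have h' : cst • (m τ • cross (φ τ) d - ∫ σ in Icc a b, k (σ - τ) • cross (φ σ) d)
        + (1 / 2 : ℝ) • φ τ + α • cross e (φ τ) + w' τ • φ τ + w τ • φ' τ
        - cst • (k (τ - b) • cross ep d + k (τ - a) • cross em d) = 0 := by rw [h, sub_self]
    have h'' := congrArg (fun v => ⟪v, Y τ⟫) h'
    simp only [inner_zero_left, inner_sub_left, inner_add_left, inner_smul_left, conj_trivial] at h''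
    simp only [inner_add_left, inner_smul_left, conj_trivial]
    linear_combination h''
  have hzero : ∫ τ in a..b, (⟪cst • (m τ • cross (φ τ) d) + (1 / 2 : ℝ) • φ τ + α • cross e (φ τ), Y τ⟫
      - cst * ⟪∫ σ in Icc a b, k (σ - τ) • cross (φ σ) d, Y τ⟫ + ⟪w' τ • φ τ + w τ • φ' τ, Y τ⟫
      - cst * ⟪k (τ - b) • cross ep d, Y τ⟫ - cst * ⟪k (τ - a) • cross em d, Y τ⟫) = 0 := by
    rw [← intervalIntegral.integral_zero (a := a) (b := b)]
    refine intervalIntegral.integral_congr fun τ hτ => ?_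
    rw [uIcc_of_le hab.le] at hτ
    exact hG τ hτ
  rw [intervalIntegral.integral_sub ((((hi1.sub (hi2.const_mul cst)).add hi3).sub ((hi4 b ep).const_mul cst)))
      ((hi4 a em).const_mul cst), intervalIntegral.integral_sub (((hi1.sub (hi2.const_mul cst)).add hi3))
      ((hi4 b ep).const_mul cst), intervalIntegral.integral_add (hi1.sub (hi2.const_mul cst)) hi3,
      intervalIntegral.integral_sub hi1 (hi2.const_mul cst), intervalIntegral.integral_const_mul,
      intervalIntegral.integral_const_mul, intervalIntegral.integral_const_mul] at hzero
  linarith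

end Summit.NavierStokesRegularity.NavierStokesRegularity.Theorems.Clause13REdgeMeasureModel

end
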